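import Summits.QuantumFields.YangMills.Theorems.UnitScaleTiltProp8FlatCubeSequenceAligned
import Summits.QuantumFields.YangMills.Theorems.UnitScaleTiltProp8FlatCubeLevels
import HarnessLib

/-!
# Route `UnitScaleTilt`, crux K1 child «MinimiserStabilityRegPr» (stmt-QuantumFields-19200), v8 pillars P2/P5 — **THE LEVEL MAP OF THE M-ALIGNED CUBE SEQUENCE**: the F4 pen's
# weight level `levOf (cubeSetM x₀ k ρ S M) k x` IS the annulus index of `cubeSeqM x₀ k hk ρ S M hM` ([Balaban1984PropagatorsII] (2.3)–(2.4)), so P2's `IsLevWeight` read at P5's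
# instance `cubeSeqMT3` carries exactly the annulus weights `(L^{j(x)}η)^m` of (152) — the aligned twin of `FlatCubeSequenceLevels` (p530488)

Cell `ym3-torus` (HUMAN RULING D-0037, YM ladder rung R3), seat `ym3-torus-p1` gen 15.  `--supports stmt-QuantumFields-19200 --as helper`; count-neutral; def-free; from
`FlatCubeLevels.levOf_eq_iff_lamSite_of_agree` (p529477) and `FlatCubeSequenceAligned.inOm_cubeSeqM_iff` (p533572).

References: [Balaban1985Variational] (144) p.300, p.286, (152) p.301; [Balaban1984PropagatorsII] (2.1)–(2.4) p.224.
-/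

set_option autoImplicit false

namespace Summit.QuantumFields.YangMills.Theorems.FlatCubeSequenceAlignedLevels

open Literature.MathematicalPhysics.QuantumFieldTheory.Balaban1983to89
open B6SectADomainsV1 (Domains)
open B5Eq118OneStroke (iterBlockOf)
open B11Eq115Space (levOf)
open FlatCubeSequenceAligned (cubeSeqM cubeSetM cubeSeqMT3 inOm_cubeSeqM_iff)
open FlatCubeLevels (levOf_eq_iff_lamSite_of_agree)

variable {P : Params}

/-- `cubeSetM` reads `cubeSeqM` at the positive levels. [cite: Balaban1985Variational, (144) p.300] -/
theorem cubeSetM_agree (x₀ : Site P 0) {k : ℕ} (hk : k ≤ P.m + P.K) (ρ S M : ℕ) (hM : 1 ≤ M) (x : Site P 0) :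
    ∀ j, 1 ≤ j → j ≤ (cubeSeqM x₀ k hk ρ S M hM).k → (x ∈ cubeSetM x₀ k ρ S M j ↔ (cubeSeqM x₀ k hk ρ S M hM).InOm j x) :=
  fun _ hj hjk => (inOm_cubeSeqM_iff hk hM hj hjk x).symm

/-- **THE WEIGHT LEVEL OF THE ALIGNED CUBE SEQUENCE IS THE ANNULUS INDEX**: `levOf (cubeSetM x₀ k ρ S M) k x = j ↔` the `j`-block of `x` lies in `Λ′_j` of `cubeSeqM`.
[cite: Balaban1985Variational, (144) p.300, p.286; Balaban1984PropagatorsII, (2.3)-(2.4) p.224] -/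
theorem levOf_cubeSetM_eq_iff_lamSite (x₀ : Site P 0) {k : ℕ} (hk : k ≤ P.m + P.K) (ρ S M : ℕ) (hM : 1 ≤ M) (x : Site P 0) (j : ℕ) :
    levOf (cubeSetM x₀ k ρ S M) k x = j ↔ (cubeSeqM x₀ k hk ρ S M hM).LamSite j (iterBlockOf j x) :=
  levOf_eq_iff_lamSite_of_agree (cubeSeqM x₀ k hk ρ S M hM) (cubeSetM_agree x₀ hk ρ S M hM x) j

/-- every fine site lies over the annulus of its level. [cite: Balaban1984PropagatorsII, (2.4) p.224] -/
theorem lamSite_levOf_cubeSetM (x₀ : Site P 0) {k : ℕ} (hk : k ≤ P.m + P.K) (ρ S M : ℕ) (hM : 1 ≤ M) (x : Site P 0) :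
    (cubeSeqM x₀ k hk ρ S M hM).LamSite (levOf (cubeSetM x₀ k ρ S M) k x) (iterBlockOf (levOf (cubeSetM x₀ k ρ S M) k x) x) :=
  (levOf_cubeSetM_eq_iff_lamSite x₀ hk ρ S M hM x _).1 rfl

/-- the weight level agrees with the `Domains`-side level `levOf (j ↦ {x | D.InOm j x})` of `FlatCubeOpsText.IsLevWeight` for `D := cubeSeqM …`.
[cite: Balaban1985Variational, p.286; Balaban1984PropagatorsII, (2.3) p.224] -/
theorem levOf_cubeSetM_eq_levOf_inOm (x₀ : Site P 0) {k : ℕ} (hk : k ≤ P.m + P.K) (ρ S M : ℕ) (hM : 1 ≤ M) (x : Site P 0) :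
    levOf (cubeSetM x₀ k ρ S M) k x = levOf (fun j => {y : Site P 0 | (cubeSeqM x₀ k hk ρ S M hM).InOm j y}) k x :=
  FlatCubeLevels.levOf_congr_pos fun j hj hjk => by
    simpa using (inOm_cubeSeqM_iff hk hM hj hjk x).symm

section T3

open T3ContinuumYM3Torus (T3Family)

/-- **AT THE d = 3 CARRIER** (`k = K − n`): the weight level of `Ω := cubeSetM x₀ (K−n) ρ S M` is the annulus index of P5's instance `cubeSeqMT3 F n K x₀ ρ S M hM`.
[cite: Balaban1985Variational, (144) p.300, (152) p.301] -/
theorem levOf_cubeSetM_T3_eq_iff (F : T3Family) (n K : ℕ) (x₀ : Site (F.P K) 0) (ρ S M : ℕ) (hM : 1 ≤ M) (x : Site (F.P K) 0) (j : ℕ) :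
    levOf (cubeSetM x₀ (K - n) ρ S M) (K - n) x = j ↔ (cubeSeqMT3 F n K x₀ ρ S M hM).LamSite j (iterBlockOf j x) :=
  levOf_cubeSetM_eq_iff_lamSite x₀ (FlatMinimizerH.le_T3 F n K) ρ S M hM x j

end T3

end Summit.QuantumFields.YangMills.Theorems.FlatCubeSequenceAlignedLevels
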